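import Literature.MathematicalPhysics.QuantumFieldTheory.Balaban1983to89.Node00.N24Thm1Stage13RebindXWithB8PinB10YZW0SepCoPHG
import Summits.QuantumFields.YangMills.Theorems.BalabanUVNodesK1RunwiseLettersOfBoxHAtRecord
import Summits.QuantumFields.YangMills.Theorems.BalabanUVNodesK1WindowExactCriterion
import Summits.QuantumFields.YangMills.Theorems.BalabanUVNodesK1NodeOLadderRunwiseEdges
import Summits.QuantumFields.YangMills.Theorems.BalabanUVNodesN13Cor3AEKeepZeroOfEnginesRowAtRecord13
import Summits.QuantumFields.YangMills.Theorems.BalabanUVNodesN12AtRecord12Pointed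
import Summits.QuantumFields.YangMills.Theorems.BalabanUVNodesN17RunRemAtOfShiftAnchorLevel
import Summits.QuantumFields.YangMills.Theorems.BalabanUVNodesK1V6Defs

/-!
# NODE N24 (B2) — PART 37 (THE SLOT ROAD, `Slot8` PARAMETRIC, N13 IN THE A.E. CURRENCY) AT AN ABSTRACT WITNESS ∕ AN ABSTRACT WITNESS FAMILY: THE POINTED THEOREM-1 DOOR, K1⁹'s CONSEQUENT
# PER `F`, AND K1⁹ `StabilityBRunRowsAtRecordR13SepCoPHV` (stmt-QuantumFields-27364) BY ITS ROUTE NAME — DOOR-FREE AND WITNESS-FREE, so that every concrete door (blind θᴴ, z-witness θᴴᶻ,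
# Gauss-pin certificate θᴳᶻ, cured embedding, any future pin of `(Efl, logz)`, any K0 face V19 ∕ V20-G) is ONE `exact` of this file — the slot-road twin of p639124

TRACK A (YM-PLAN §2d, node N24 of 28 = binder B2), seat `pub-ymgap-dag-n24-c` (R134 s2; gen 13, CLAIM-59).  Key of record K1⁹ = stmt-QuantumFields-27364 (`--kind proof --supports 27364 --as helper`,
Summits lane; count-neutral).  [V] = [Balaban1989LargeFieldII]; [III] = [Balaban1988Convergent]; [I] = [Balaban1987RG1]; [B8] = [Balaban1985RegularSpaces].

WHY.  This lineage's slot road (Part 37 p626256 → z-keyed p644387 → Gauss-pin p646xxx, each with its κ-∕P₂D-instances) has been RE-TYPED by token pass at every witness edition (FLAG №9's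
z-edition, today's θᴴᶻ ↦ θᴳᶻ switch), ≈400 lines each time; the LINE-2′ rung road stopped doing that at p639124 (abstract witness + four door rows ⇒ instances by one `exact`: p641655,
p643157, p646378).  THIS FILE is the slot road's p639124: Part 37's five theorems with the concrete witness `θ₁₅ᶜᶜᴹᵂᶻ(j; γ; …)`, its door lemma and its K0-text prelude ABSTRACTED to
`(θ : Stage13HParams F N) (hP : θ.Provisos₁₃SepCoPH) (hθ : θ.Admissible) (hU : θ.ZhUnity ∧ θ.SlotsNondegenerate₁₃) (hlaws : ∀ P k, k < P.K → TLaw₁₃CoPH θ P k → SLaw₁₃CoPH θ P (k+1))`, the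
step window read as the witness's OWN letter `θ.γ` (`0 < θ.γ`, upper box `BetaUpperH β' θ.γ (β θ)`; two-sided for the sharp NODE-O bill), the children families READ AT `θ` (N05 at the slot
PARAMETER `Slot8`; N08's [B10] statement at `θ.L`), and — for the `∀ F` theorems — an abstract witness FAMILY `Θ F i` over index types `ι F` with the K0 face `hK0 : ∀ F, Inhabited13 F →
Nonempty (ι F)` (p639124 §3's packaging).  Kernel facts surfaced by the abstraction (both were `rfl` at concrete doors): the engine reads the world's step ceiling against `θ.γ` and N08's leaf at
`θ.L`.

EDITION 2 (CLASS S, IN PLACE — seat g21, 2026-08-30; director-ym №365 (3) ∕ №395 road (i); this seat's `N24-G20-ENGINE-V2-DESIGN.md` §3 (b); twin of `…AtAbstractWitnessY0` EDITION 2 ✓p781642).  The five public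
STATEMENTS are BYTE-IDENTICAL to edition 1 (gen 13, CLAIM-59); only the IMPORTS and five proof tokens changed.  Edition 1 imported `…Slot8Thm1AEAtThm1CCMWZ` (⇒ the `…WorldBuilt` chain), post-Stage-2
RESIDUE (own-text red after rows 10d∕10e — node00-def-RR-2 FINDING-2, dag-n11-d's probes I.19732); of that chain the proofs read exactly four small run-wise lemmas, now taken from dag-n07-w3's residue-free
homes `K1RunwiseLettersOfBoxH.runCeiling_of_betaUpperH ∕ exists_frequently_betaZero_le_of_runCeiling` (✓p775657) and `K1RunwiseLettersOfBoxHAtRecord.flowStepPrinted_leavesP_of_betaUpperH_noShrinkG ∕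
runConstRemainder_zero_of_boxH'` (✓p776781); `survCont_anti` is read from its home `…N17RunRemAtOfShiftAnchorLevel` directly; the vocabulary modules the statements need are imported directly; the stale
`open … (…)` lines of the residue chain are dropped.  No consumer today (the engine v2 reads the Y0 twin); kept green as the door-free abstract-witness K1 theorem for later lines.  Nothing else changed.

WHAT THIS FILE PROVES (5 theorems, 0 `def`, 0 `sorry`; standard axioms; general `N` in §1, `N = 2` in §2–§5).
§1 `N24_thm1R13SepCoPH_worldBuiltG_childrenSplitSlot8_psFloor_atWitness_pointed` — THE POINTED THEOREM-1 DOOR AT AN ABSTRACT WITNESS: guard ∧ admissible ∧ `B16.Thm1Printed (datumOfRecord₁₃SepCoPH F N θ hP).C`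
   ∧ window, from the four door rows, `0 < θ.γ` + upper box, N05 (`Slot8`), N06–N10 (+ `h09T`), N11's `h11`, NODE O's PS floor — p644387 §1's proof VERBATIM at `θ` (X3 (a) world, level below the
   no-shrink level, Part 36 §1 eleven nodes + 𝐑-leaf, Part 32 §0 flow step, Part 36 §0 Theorem 1, window by `window_of_frequently_beta_le`).
§2 `N24_stabilityBRunRowsR13SepCoPHV_consequent_childrenSplitSlot8Thm1AE_atWitness_of_runRowsCont` (per `F`, one abstract witness) — K1⁹'s body at `F` with the slot's teeth (θ re-used as `θ'`,
   datum re-chosen by dag-n13-w2's θ-generic `exists_revision₁₃_endStatementBPrinted_of_thm1_of_row0_of_aeRowSucc`), N13 in the a.e. currency at `θ`, NODE O = run rows.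
§3 ★★★★ `N24_stabilityBRunRowsAtRecordR13SepCoPHV_byName_of_abstractWitnessFamily_childrenSplitSlot8Thm1AE_of_runRowsCont` — K1⁹ BY ITS ROUTE NAME from an abstract witness family.
§4 `…_atWitness_of_psFloorSurvCont` (per `F`; two-sided box ⇒ row (i) free by `runConstRemainder_zero_of_boxH`, (C) shrunk by `survCont_anti`) · §5 ★★★★ `…_of_abstractWitnessFamily_…_of_psFloorSurvCont`.
INSTANCES OF RECORD (not restated here — the gate dedups identical statements): p644387 (θᴴᶻ, V19 texts), p644924 (its κ-instance, FLAG №10's road), this seat's θᴳᶻ editions CLAIM-56∕57.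

WHICH CHILD BLOCKS (kernel form = §3's hypotheses, per index): the four door rows (K0's currency-free face: `hP hθ hU hlaws` + `hK0`); N05 `h05` at `Slot8`; N06 `h06`; N07 `h07`; N08 `h08` at `θ.L`;
N09 `h09` + `h09T`; N10 `h10`; N11 `h11` (any road: token ∕ continuity ∕ operand rows — at θᴳᶻ dag-n11-w1's `h11Family_gaussPinH_…` fills it); N13 `h13` (a.e. (2.50) rows at `θ`); NODE O `hrowsR`
∕ `hpc`; the window ∕ box letters on `β θ`.

HONEST FRAMING.  Composition BY NAME (an abstraction of this seat's own Part 37; every proof step is p644387's at `θ`); NO estimate; nothing of Bałaban's asserted; every family DISPLAYED as a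
hypothesis (CONDITIONAL, audit `proof.conditional`); NOT a claim that any particular `θ` is K1⁹'s witness; no v10 stub used or closed; N05 ∕ N11 ∕ N13 NOT discharged; N24 COMPOSITE — no
count moved (typed 28∕28 · discharged 5∕27 · A 5∕28); K0⁷ ∕ K1⁹ stmt-QuantumFields-27364 (DECIDING; v10 0∕6) ∕ K3⁸ OPEN; one finite 𝕋⁴ programme at fixed ε, Bałaban AS PRINTED; R4 = the
conditional finite-𝕋⁴ rung `BalabanLadder.UV` only — NOT continuum ∕ ℝ⁴ ∕ OS ∕ mass gap ∕ Clay: the Yang–Mills mass gap is NOT proved by any of this.  No `sorry`, `def`, `instance`,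
`notation`; standard axioms.
-/

noncomputable section

open scoped Matrix.Norms.L2Operator BigOperators
open Filter Topology MeasureTheory

namespace Summit.QuantumFields.YangMills.BalabanUVNodes.N24K1R9ByNameOfOpenStubsChildrenSplitSlot8Thm1AEAtAbstractWitness

open Literature.MathematicalPhysics.QuantumFieldTheory.Balaban1983to89
open Literature.MathematicalPhysics.QuantumFieldTheory.Balaban1983to89.Node00
open DagBinding T4Continuum T4DatumAssembly FlowStepRuns AveragingRT
open FlowStep (HBeta RGEqH prefixOf prefixOf_apply BetaLowerH BetaUpperH Box mem_box clampPrefix Y)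
open Summit.QuantumFields.YangMills.BalabanUVNodes.N12AtRecord12Pointed (exists_printedCarriers15_b15Leaf)
open Summit.QuantumFields.YangMills.Theorems.K1RunwiseLettersOfBoxH (runCeiling_of_betaUpperH exists_frequently_betaZero_le_of_runCeiling)
open Summit.QuantumFields.YangMills.Theorems.K1RunwiseLettersOfBoxHAtRecord (flowStepPrinted_leavesP_of_betaUpperH_noShrinkG runConstRemainder_zero_of_boxH')
open Summit.QuantumFields.YangMills.Theorems.BalabanUVNodesK1WindowExactCriterion (window_of_frequently_beta_le)
open Summit.QuantumFields.YangMills.Theorems.K1NodeOLadderRunwiseEdges (exists_noShrink_of_psFloor)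
open Summit.QuantumFields.YangMills.BalabanUVNodes.N13Cor3AEKeepZeroOfEnginesRowAtRecord13 (exists_revision₁₃_endStatementBPrinted_of_thm1_of_row0_of_aeRowSucc)
open Summit.QuantumFields.YangMills.BalabanUVNodes.N17RunRemAtOfShiftAnchorLevel (survCont_anti)


open Summit.QuantumFields.YangMills.Theorems.K1V6Defs (Inhabited13)

variable {F : T4Family} {N : ℕ} [NeZero N]

/-! ## §1. General `N`: THE POINTED THEOREM-1 DOOR AT AN ABSTRACT WITNESS (N05 at `Slot8`, N06–N11, NODE O's PS floor; N12- and N13-free) -/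

/-- **THE POINTED THEOREM-1 DOOR AT AN ABSTRACT WITNESS `θ : Stage13HParams F N` (general `N`; N12- AND N13-FREE)** — p644387 §1 with the concrete witness, its door lemma and its letters
abstracted: from the four door rows `hP hθ hU hlaws`, the witness's own step window `0 < θ.γ` with an upper β-box `BetaUpperH β' θ.γ (β θ)`, N05 (slot parameter `Slot8`), N06, N07, N08 (at
`θ.L`), N09 (+ Theorem-3 member `h09T` at the datum), N10, N11 (S1ᵀ shape `h11` at the datum) and NODE O's run-wise partial-sum floor `hps` ⊢ the guard ∧ admissibility ∧ **[16] THEOREM 1's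
CLAUSE `B16.Thm1Printed (datumOfRecord₁₃SepCoPH F N θ hP).C`** ∧ the window.  World = X3 (a) §1's (`(βup, β₀) := (β′, 1)`, `b8 ↦ Slot8 θ₃ λ₈`, level chosen below dag-n24-w1's no-shrink level
`γ′`, [IV] slot pinned to dag-n12-d's leaf-carrying degenerate family, exponents `(0, 0)`); eleven nodes + 𝐑-leaf by Part 36 §1; flow step by Part 32 §0; Theorem 1 by Part 36 §0; window by
`window_of_frequently_beta_le` ∘ `frequently_betaZero_le_of_runwiseCeiling`; `1 < θ.L` from `θ`'s own `hL`.  CONDITIONAL; nothing of Bałaban asserted. [cite: Balaban1989LargeFieldII, Thm 1 p.355, p.387, p.391; Balaban1987RG1, Thm 3 p.264, (1.20)–(1.22) p.264, §1 pp.263–264, (5.10) p.293, (0.17)–(0.20) pp.255–256, Thm 2 p.259; Balaban1988RG2Cluster, (2.41) p.21; Balaban1988Convergent, (2.6) p.255, Thm 2 p.263, Theorem p.245; Balaban1985RegularSpaces, Prop. 7 (1.145) p.100, Thm 8 (1.146) p.101; Balaban1985UV3, Thm 1 p.257; Balaban1989LargeFieldI, (0.2)–(0.6) p.176, Prop. 1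 p.194 (bookkeeping)] -/
theorem N24_thm1R13SepCoPH_worldBuiltG_childrenSplitSlot8_psFloor_atWitness_pointed (Slot8 : (θ₃ : Stage3Params) → ResidB8 θ₃ → Prop) (θ : Stage13HParams F N)
    (hP : θ.Provisos₁₃SepCoPH F N) (hθ : θ.Admissible F N) (hU : θ.ZhUnity F N ∧ θ.SlotsNondegenerate₁₃ F N)
    (hlaws : ∀ (P : B12.RunParams) (k : ℕ), k < P.K → TLaw₁₃CoPH F N θ P k → SLaw₁₃CoPH F N θ P (k + 1))
    {β' : ℝ} (hγ₀ : 0 < θ.γ) (hbox' : BetaUpperH β' θ.γ (betaOfRecord₁₃ F N θ.toStage13Params))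
    (h05 : ∃ lam8 : ResidB8 θ.toStage13Params.toStage3Params, Slot8 θ.toStage13Params.toStage3Params lam8)
    (h06 : ∃ (Mstar : ℕ) (ops : OpsY N θ.toStage13Params.toStage3Params Mstar), B9LeafX (Y9OfRecord N θ.toStage13Params.toStage3Params Mstar ops))
    (h07 : ∃ ζ : ResidZ F N, B11Leaf (Z11OfRecord F N ζ))
    (h08 : PrintedUV3V N θ.L)
    (h09 : ∃ lam12 : ResidB12 F N θ.toStage13Params.τ9.M,
      ∀ P : B12.RunParams, B12Sec2to5.Lemma4Printed (F12OfRecord₁₂ F N θ.toStage13Params.toStage12Params lam12 P) (lam12 P).consts)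
    (h09T : ∃ γ₉ : ℝ, 0 < γ₉ ∧ ∀ w : WorldP, w.C = (datumOfRecord₁₃SepCoPH F N θ hP).C →
      w.γ ≤ γ₉ → ∀ P : B12.RunParams, (leavesP w P).smallCouplings → (leavesP w P).smallFieldInductive)
    (h10 : ∃ lam13 : B12.RunParams → ResidB13 θ.toStage13Params.toStage3Params,
      ∀ P : B12.RunParams, B13LeafOfRecord θ.toStage13Params.toStage3Params (lam13 P))
    (h11 : ∀ βup β₀ : ℝ, ∃ γ₁₁ : ℝ, 0 < γ₁₁ ∧ ∀ w : WorldP, w.C = (datumOfRecord₁₃SepCoPH F N θ hP).C →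
      w.βup = βup → w.β₀ = β₀ → w.γ ≤ γ₁₁ → ∀ P : B12.RunParams, (leavesP w P).b7 → (leavesP w P).b8 → (leavesP w P).b9 → (leavesP w P).b10 → (leavesP w P).b11 →
      (leavesP w P).smallCouplings → (leavesP w P).smallFieldInductive → (leavesP w P).flowControl →
        ∀ k, k < P.K → SLaw₁₃CoPH F N θ P k → TLaw₁₃CoPH F N θ P k)
    {γR M : ℝ} (hγR : 0 < γR)
    (hps : ∀ (n : ℕ) (gs : ℕ → ℝ), RGEqH n (betaOfRecord₁₃ F N θ.toStage13Params) gs → Step.InInterval γR n gs → ∀ k, k ≤ n → -M ≤ ∑ j ∈ Finset.Ico k n, betaOfRecord₁₃ F N θ.toStage13Params j (prefixOf gs j)) :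
    (θ.ZhUnity F N ∧ θ.SlotsNondegenerate₁₃ F N) ∧ θ.Admissible F N ∧
      B16.Thm1Printed (datumOfRecord₁₃SepCoPH F N θ hP).C ∧
      ∃ γ₁ : ℝ, 0 < γ₁ ∧ ∀ γ' : ℝ, 0 < γ' → γ' ≤ γ₁ → ∃ P : B12.RunParams, 1 ≤ P.K ∧ ((datumOfRecord₁₃SepCoPH F N θ hP).C P).flow.InInterval γ' P.K := by
  obtain ⟨lam8, h05⟩ := h05
  obtain ⟨Mstar, ops, h06⟩ := h06
  obtain ⟨ζ, h07⟩ := h07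
  obtain ⟨lam12, h09⟩ := h09
  obtain ⟨lam13, h10⟩ := h10
  obtain ⟨γ₉, hγ₉, h09T⟩ := h09T
  obtain ⟨γ₁₁, hγ₁₁, h11⟩ := h11 β' 1
  obtain ⟨γ', hγ', -, hns⟩ := exists_noShrink_of_psFloor one_pos hγR hps
  have hL1 : (1 : ℝ) < (θ.toStage13Params.L : ℝ) := by exact_mod_cast θ.toStage13Params.hL.2
  have hγw0 : 0 < min θ.γ (min γ₉ (min γ₁₁ γ')) := lt_min hγ₀ (lt_min hγ₉ (lt_min hγ₁₁ hγ'))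
  have hγwγ : min θ.γ (min γ₉ (min γ₁₁ γ')) ≤ θ.γ := min_le_left _ _
  have hγw9 : min θ.γ (min γ₉ (min γ₁₁ γ')) ≤ γ₉ := (min_le_right _ _).trans (min_le_left _ _)
  have hγw11 : min θ.γ (min γ₉ (min γ₁₁ γ')) ≤ γ₁₁ := (min_le_right _ _).trans ((min_le_right _ _).trans (min_le_left _ _))
  have hγw13 : min θ.γ (min γ₉ (min γ₁₁ γ')) ≤ γ' := (min_le_right _ _).trans ((min_le_right _ _).trans (min_le_right _ _))
  set γw : ℝ := min θ.γ (min γ₉ (min γ₁₁ γ'))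
  let w : WorldP :=
    { C := (datumOfRecord₁₃SepCoPH F N θ hP).C
      γ := γw, em := fun _ => 0, ep := fun _ => 0, βup := β', β₀ := 1, β₀_pos := one_pos, b := 1, b_pos := one_pos
      L := (θ.toStage13Params.L : ℝ), one_lt_L := hL1, gR := 0
      up := fun P => (upOfRecord₅C F N ((((((θ.rebindX F N (fun P : B12.RunParams => (((θ.toStage13Params.res.X P).withB12 (F12OfRecord₁₂ F N θ.toStage13Params.toStage12Params lam12 P) (lam12 P).consts).withB13OfRecord θ.toStage13Params.toStage3Params (lam13 P)))).toStage5₁₃CoPH F N).pinB10 F N).pinY F N (Y9OfRecord N θ.toStage13Params.toStage3Params Mstar ops)).pinZ F N (Z11OfRecord F N ζ)).pinW F N (fun P : B12.RunParams => (exists_printedCarriers15_b15Leaf (F.P P.K)).choose)) P).withB8 (Slot8 θ.toStage13Params.toStage3Params lam8) }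
  have hC : w.C = (datumOfRecord₁₃SepCoPH F N θ hP).C := rfl
  have hR := N24_recordG₁₃SepCoPH_of_up_withB8_rebindX_pinB10YZW₀ θ hP hθ
    (fun P : B12.RunParams => (((θ.toStage13Params.res.X P).withB12 (F12OfRecord₁₂ F N θ.toStage13Params.toStage12Params lam12 P) (lam12 P).consts).withB13OfRecord θ.toStage13Params.toStage3Params (lam13 P))) Mstar ops ζ
    (fun P : B12.RunParams => (exists_printedCarriers15_b15Leaf (F.P P.K)).choose) (fun _ => Slot8 θ.toStage13Params.toStage3Params lam8) w hC ⟨hγw0, hγwγ⟩ rfl (fun P => rfl)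
  have hnodes := N24_nodes11_rOperation₁₃CoPH_rebindX_withB8_pinB10YZW₀_pointed θ hP.toCore hθ
    (fun P : B12.RunParams => (((θ.toStage13Params.res.X P).withB12 (F12OfRecord₁₂ F N θ.toStage13Params.toStage12Params lam12 P) (lam12 P).consts).withB13OfRecord θ.toStage13Params.toStage3Params (lam13 P))) Mstar ops ζ
    (fun P : B12.RunParams => (exists_printedCarriers15_b15Leaf (F.P P.K)).choose) (fun _ => Slot8 θ.toStage13Params.toStage3Params lam8) w hC ⟨hγw0, hγwγ⟩ rfl (fun P => rfl)
    (fun P => h05) h06 h07 h08 (fun P => h09 P) (h09T w hC hγw9) (fun P _ _ _ _ => h10 P) (h11 w hC rfl rfl hγw11) hlaws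
  have hceil := runCeiling_of_betaUpperH hbox' (min_le_left θ.γ γ')
  have hflow : ∀ P : B12.RunParams, Dag.FlowStepPrinted (leavesP w P) :=
    flowStepPrinted_leavesP_of_betaUpperH_noShrinkG hR (le_min hγwγ hγw13) (min_le_left θ.γ γ') hbox'
      (fun n gs hrg hI m n' hmn hn' => hns n gs hrg (fun k hk => ⟨(hI k hk).1, (hI k hk).2.trans (min_le_right θ.γ γ')⟩) m n' hmn hn')
  have h1 : B16.Thm1Printed w.C := thm1Printed_of_nodes11_of_rOperation w hγw0 (fun P => (hnodes P).1) (fun P => (hnodes P).2) hflow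
  refine ⟨hU, hθ, ?_, window_of_frequently_beta_le _ (exists_frequently_betaZero_le_of_runCeiling (lt_min hγ₀ hγ') hceil)⟩
  rw [← hC]
  exact h1



/-! ## §2. `N = 2`, per `F`: K1⁹'s consequent at an abstract witness (N13 in the a.e. currency at `θ`, (B) at a re-chosen datum by dag-n13-w2's junction) -/

/-- **★★★ K1⁹'s θ-KEYED CONSEQUENT AT `F` WITH THE VERSION SLOT'S TEETH, AT AN ABSTRACT ADMISSIBLE WITNESS** `θ : Stage13HParams F 2` carrying the four door rows (`hP` provisos,
`hθ` admissible, `hU` unity ∧ non-degeneracy, `hlaws` the (R₁₃) law chain), a step window `0 < θ.γ` with an upper β-box `BetaUpperH β' θ.γ (β θ)`, the world-free children families READ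
AT `θ` (N05 at `Slot8`, N06, N07, N08, N09 + `h09T`, N10, N11), N13 IN THE A.E. CURRENCY at `θ` and NODE O's RUN-ROWS family on `β θ` ⊢ the body of K1⁹ at `F` (the witness RE-USED as
`θ'`, the datum re-chosen by dag-n13-w2's θ-generic junction `exists_revision₁₃_endStatementBPrinted_of_thm1_of_row0_of_aeRowSucc`).  Door-free: every concrete door (blind ∕ z ∕ Gauss-pin
∕ cured ∕ any future pin of `(Efl, logz)`) is ONE `exact` of this theorem.  CONDITIONAL; nothing of Bałaban asserted; N13 NOT discharged. [cite: Balaban1989LargeFieldII, Thm 1 p.355, (0.1) pp.355–356, p.391; Balaban1988Convergent, Cor. 3 (2.50) p.264, (0.2) p.244, (2.6) p.255; Balaban1987RG1, Thm 3 p.264, (1.20)–(1.22) p.264, §1 pp.263–264, (0.17)–(0.20) pp.255–256; Balaban1985RegularSpaces, Prop. 7 (1.145) p.100, Thm 8 (1.146) p.101 (bookkeeping)] -/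
theorem N24_stabilityBRunRowsR13SepCoPHV_consequent_childrenSplitSlot8Thm1AE_atWitness_of_runRowsCont (Slot8 : (θ₃ : Stage3Params) → ResidB8 θ₃ → Prop) (θ : Stage13HParams F 2)
    (hP : θ.Provisos₁₃SepCoPH F 2) (hθ : θ.Admissible F 2) (hU : θ.ZhUnity F 2 ∧ θ.SlotsNondegenerate₁₃ F 2)
    (hlaws : ∀ (P : B12.RunParams) (k : ℕ), k < P.K → TLaw₁₃CoPH F 2 θ P k → SLaw₁₃CoPH F 2 θ P (k + 1))
    {β' : ℝ} (hγ₀ : 0 < θ.γ) (hbox' : BetaUpperH β' θ.γ (betaOfRecord₁₃ F 2 θ.toStage13Params))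
    (h05 : ∃ lam8 : ResidB8 θ.toStage13Params.toStage3Params, Slot8 θ.toStage13Params.toStage3Params lam8)
    (h06 : ∃ (Mstar : ℕ) (ops : OpsY 2 θ.toStage13Params.toStage3Params Mstar), B9LeafX (Y9OfRecord 2 θ.toStage13Params.toStage3Params Mstar ops))
    (h07 : ∃ ζ : ResidZ F 2, B11Leaf (Z11OfRecord F 2 ζ))
    (h08 : PrintedUV3V 2 θ.L)
    (h09 : ∃ lam12 : ResidB12 F 2 θ.toStage13Params.τ9.M,
      ∀ P : B12.RunParams, B12Sec2to5.Lemma4Printed (F12OfRecord₁₂ F 2 θ.toStage13Params.toStage12Params lam12 P) (lam12 P).consts)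
    (h09T : ∃ γ₉ : ℝ, 0 < γ₉ ∧ ∀ w : WorldP, w.C = (datumOfRecord₁₃SepCoPH F 2 θ hP).C →
      w.γ ≤ γ₉ → ∀ P : B12.RunParams, (leavesP w P).smallCouplings → (leavesP w P).smallFieldInductive)
    (h10 : ∃ lam13 : B12.RunParams → ResidB13 θ.toStage13Params.toStage3Params,
      ∀ P : B12.RunParams, B13LeafOfRecord θ.toStage13Params.toStage3Params (lam13 P))
    (h11 : ∀ βup β₀ : ℝ, ∃ γ₁₁ : ℝ, 0 < γ₁₁ ∧ ∀ w : WorldP, w.C = (datumOfRecord₁₃SepCoPH F 2 θ hP).C →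
      w.βup = βup → w.β₀ = β₀ → w.γ ≤ γ₁₁ → ∀ P : B12.RunParams, (leavesP w P).b7 → (leavesP w P).b8 → (leavesP w P).b9 → (leavesP w P).b10 → (leavesP w P).b11 →
      (leavesP w P).smallCouplings → (leavesP w P).smallFieldInductive → (leavesP w P).flowControl →
        ∀ k, k < P.K → SLaw₁₃CoPH F 2 θ P k → TLaw₁₃CoPH F 2 θ P k)
    (h13 : ∃ γ₁₃ : ℝ, 0 < γ₁₃ ∧ ∃ em ep : ℝ → ℝ,
        (∀ P : B12.RunParams, ((datumOfRecord₁₃SepCoPH F 2 θ hP).C P).flow.InInterval γ₁₃ P.K → SLaw₁₃CoPH F 2 θ P 0 →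
      ∀ U : GaugeField (F.P P.K) 0 (SU 2),
        chiβOfRecord₁₃ F 2 θ.toStage13Params P.K (gOfRecord₁₃ F 2 θ.toStage13Params P) 0 U *
              Real.exp (-(1 / (gOfRecord₁₃ F 2 θ.toStage13Params P 0) ^ 2 * wilsonBGOfRecord F 2 θ.εbg P 0 U)
                - em (gOfRecord₁₃ F 2 θ.toStage13Params P 0) * (Fintype.card (Site (F.P P.K) 0) : ℝ)) ≤ densOfRecord₁₃ F 2 θ.toStage13Params P 0 U ∧
          densOfRecord₁₃ F 2 θ.toStage13Params P 0 U ≤ Real.exp (ep (gOfRecord₁₃ F 2 θ.toStage13Params P 0) * (Fintype.card (Site (F.P P.K) 0) : ℝ))) ∧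
        (∀ P : B12.RunParams, ((datumOfRecord₁₃SepCoPH F 2 θ hP).C P).flow.InInterval γ₁₃ P.K → ∀ k, k + 1 ≤ P.K → SLaw₁₃CoPH F 2 θ P (k + 1) →
      ∀ᵐ U ∂(fieldMeasure (F.P P.K) (k + 1) (SU 2)),
        chiβOfRecord₁₃ F 2 θ.toStage13Params P.K (gOfRecord₁₃ F 2 θ.toStage13Params P) (k + 1) U *
              Real.exp (-(1 / (gOfRecord₁₃ F 2 θ.toStage13Params P (k + 1)) ^ 2 * wilsonBGOfRecord F 2 θ.εbg P (k + 1) U)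
                - em (gOfRecord₁₃ F 2 θ.toStage13Params P (k + 1)) * (Fintype.card (Site (F.P P.K) (k + 1)) : ℝ)) ≤ densOfRecord₁₃ F 2 θ.toStage13Params P (k + 1) U ∧
          densOfRecord₁₃ F 2 θ.toStage13Params P (k + 1) U ≤ Real.exp (ep (gOfRecord₁₃ F 2 θ.toStage13Params P (k + 1)) * (Fintype.card (Site (F.P P.K) (k + 1)) : ℝ))))
    (hrowsR : ∃ (b : ℕ → ℝ) (r γ₀ M : ℝ), 0 < γ₀ ∧
        (∀ (n : ℕ) (gs : ℕ → ℝ), RGEqH n (betaOfRecord₁₃ F 2 θ.toStage13Params) gs → Step.InInterval γ₀ n gs → ∀ k, k ≤ n → |betaOfRecord₁₃ F 2 θ.toStage13Params k (prefixOf gs k) - b k| ≤ r) ∧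
        (∀ (n : ℕ) (gs : ℕ → ℝ), RGEqH n (betaOfRecord₁₃ F 2 θ.toStage13Params) gs → Step.InInterval γ₀ n gs → ∀ k, k ≤ n → -M ≤ ∑ j ∈ Finset.Ico k n, betaOfRecord₁₃ F 2 θ.toStage13Params j (prefixOf gs j)) ∧
        ∀ k : ℕ, ContinuousOn (fun x : ℝ => betaOfRecord₁₃ F 2 θ.toStage13Params k (clampPrefix (betaOfRecord₁₃ F 2 θ.toStage13Params) γ₀ k x))
          {x : ℝ | 0 < x ∧ x ≤ γ₀ ∧ ∀ j', j' ≤ k → 1 / γ₀ ^ 2 ≤ Y (betaOfRecord₁₃ F 2 θ.toStage13Params) γ₀ j' x}) :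
    ∃ (θ' : Stage13HParams F 2) (h' : θ'.Provisos₁₃SepCoPH F 2) (v' : Revision₁₃ F 2 θ' h'), (θ'.ZhUnity F 2 ∧ θ'.SlotsNondegenerate₁₃ F 2) ∧ θ'.Admissible F 2 ∧
      B16.EndStatementBPrinted (datumOfRecord₁₃SepCoPHV F 2 θ' h' v').C ∧
      (∃ γ₁ : ℝ, 0 < γ₁ ∧ ∀ γ : ℝ, 0 < γ → γ ≤ γ₁ → ∃ P : B12.RunParams, 1 ≤ P.K ∧ ((datumOfRecord₁₃SepCoPHV F 2 θ' h' v').C P).flow.InInterval γ P.K) ∧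
      ∃ (b : ℕ → ℝ) (r γ₀ M : ℝ), 0 < γ₀ ∧
        (∀ (n : ℕ) (gs : ℕ → ℝ), RGEqH n (betaOfRecord₁₃ F 2 θ'.toStage13Params) gs → Step.InInterval γ₀ n gs → ∀ k, k ≤ n → |betaOfRecord₁₃ F 2 θ'.toStage13Params k (prefixOf gs k) - b k| ≤ r) ∧
        (∀ (n : ℕ) (gs : ℕ → ℝ), RGEqH n (betaOfRecord₁₃ F 2 θ'.toStage13Params) gs → Step.InInterval γ₀ n gs → ∀ k, k ≤ n → -M ≤ ∑ j ∈ Finset.Ico k n, betaOfRecord₁₃ F 2 θ'.toStage13Params j (prefixOf gs j)) ∧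
        ∀ k : ℕ, ContinuousOn (fun x : ℝ => betaOfRecord₁₃ F 2 θ'.toStage13Params k (clampPrefix (betaOfRecord₁₃ F 2 θ'.toStage13Params) γ₀ k x))
          {x : ℝ | 0 < x ∧ x ≤ γ₀ ∧ ∀ j', j' ≤ k → 1 / γ₀ ^ 2 ≤ Y (betaOfRecord₁₃ F 2 θ'.toStage13Params) γ₀ j' x} := by
  obtain ⟨b, r, γR, M, hγR, hrem, hps, hcont⟩ := hrowsR
  obtain ⟨hU', hθ', hT1, hwin⟩ := N24_thm1R13SepCoPH_worldBuiltG_childrenSplitSlot8_psFloor_atWitness_pointed Slot8 θ hP hθ hU hlaws hγ₀ hbox'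
    h05 h06 h07 h08 h09 h09T h10 h11 hγR hps
  obtain ⟨γ₁₃, hγ₁₃, em, ep, h0, hae⟩ := h13
  obtain ⟨v, hB⟩ := exists_revision₁₃_endStatementBPrinted_of_thm1_of_row0_of_aeRowSucc F 2 _ _ hT1 hγ₁₃ h0 hae
  exact ⟨_, _, v, hU', hθ', hB, hwin, b, r, γR, M, hγR, hrem, hps, hcont⟩

/-! ## §3. ★★★★ K1⁹ BY ITS ROUTE NAME FROM AN ABSTRACT WITNESS FAMILY: per `F` an index type `ι F`, non-empty under `K1V6Defs.Inhabited13 F` (the K0 face), each index carrying a witness with its door rows, window ∕ box, children, N13 a.e. rows and NODE O run rows -/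

/-- **★★★★ K1⁹ `StabilityBRunRowsAtRecordR13SepCoPHV` (stmt-QuantumFields-27364) BY ITS ROUTE NAME, DOOR-FREE AND WITNESS-FREE**: from an abstract witness FAMILY `Θ F i` (index types
`ι F`, non-empty whenever `K1V6Defs.Inhabited13 F` — the K0 face in ANY currency: V19 ∕ V20-G stub texts, z- ∕ Gauss-pin ∕ cured doors all instantiate `ι`, `Θ` and the rows), per index
the four door rows, the window ∕ upper box on `β (Θ F i)`, the world-free children families at `Θ F i` (N05 at `Slot8`), N11's `h11`, N13's a.e. rows and NODE O's run rows ⊢ the route decl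
(`intro F h; obtain ⟨i⟩ := hK0 F h; exact §2 …`).  CONDITIONAL (every family displayed; audit `proof.conditional`); not a closure; no v10 stub used or closed; no count moved.
[cite: Balaban1989LargeFieldII, Thm 1 p.355, (0.1) pp.355–356, p.391; Balaban1988Convergent, Cor. 3 (2.50) p.264, (0.2) p.244; Balaban1987RG1, Thm 3 p.264, (1.20)–(1.22) p.264, §1 pp.263–264; Balaban1985RegularSpaces, Prop. 7 (1.145) p.100, Thm 8 (1.146) p.101 (bookkeeping)] -/
theorem N24_stabilityBRunRowsAtRecordR13SepCoPHV_byName_of_abstractWitnessFamily_childrenSplitSlot8Thm1AE_of_runRowsCont (Slot8 : (θ₃ : Stage3Params) → ResidB8 θ₃ → Prop)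
    (ι : T4Family → Type) (Θ : ∀ F : T4Family, ι F → Stage13HParams F 2) (hK0 : ∀ F : T4Family, Inhabited13 F → Nonempty (ι F))
    (hP : ∀ (F : T4Family) (i : ι F), (Θ F i).Provisos₁₃SepCoPH F 2) (hθ : ∀ (F : T4Family) (i : ι F), (Θ F i).Admissible F 2)
    (hU : ∀ (F : T4Family) (i : ι F), (Θ F i).ZhUnity F 2 ∧ (Θ F i).SlotsNondegenerate₁₃ F 2)
    (hlaws : ∀ (F : T4Family) (i : ι F) (P : B12.RunParams) (k : ℕ), k < P.K → TLaw₁₃CoPH F 2 (Θ F i) P k → SLaw₁₃CoPH F 2 (Θ F i) P (k + 1))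
    (βup : ∀ F : T4Family, ι F → ℝ) (hγ₀ : ∀ (F : T4Family) (i : ι F), 0 < (Θ F i).γ)
    (hbox' : ∀ (F : T4Family) (i : ι F), BetaUpperH (βup F i) (Θ F i).γ (betaOfRecord₁₃ F 2 (Θ F i).toStage13Params))
    (h05 : ∀ (F : T4Family) (i : ι F), ∃ lam8 : ResidB8 (Θ F i).toStage13Params.toStage3Params, Slot8 (Θ F i).toStage13Params.toStage3Params lam8)
    (h06 : ∀ (F : T4Family) (i : ι F), ∃ (Mstar : ℕ) (ops : OpsY 2 (Θ F i).toStage13Params.toStage3Params Mstar), B9LeafX (Y9OfRecord 2 (Θ F i).toStage13Params.toStage3Params Mstar ops))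
    (h07 : ∀ F : T4Family, ∃ ζ : ResidZ F 2, B11Leaf (Z11OfRecord F 2 ζ))
    (h08 : ∀ (F : T4Family) (i : ι F), PrintedUV3V 2 (Θ F i).L)
    (h09 : ∀ (F : T4Family) (i : ι F), ∃ lam12 : ResidB12 F 2 (Θ F i).toStage13Params.τ9.M,
      ∀ P : B12.RunParams, B12Sec2to5.Lemma4Printed (F12OfRecord₁₂ F 2 (Θ F i).toStage13Params.toStage12Params lam12 P) (lam12 P).consts)
    (h09T : ∀ (F : T4Family) (i : ι F), ∃ γ₉ : ℝ, 0 < γ₉ ∧ ∀ w : WorldP, w.C = (datumOfRecord₁₃SepCoPH F 2 (Θ F i) (hP F i)).C →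
      w.γ ≤ γ₉ → ∀ P : B12.RunParams, (leavesP w P).smallCouplings → (leavesP w P).smallFieldInductive)
    (h10 : ∀ (F : T4Family) (i : ι F), ∃ lam13 : B12.RunParams → ResidB13 (Θ F i).toStage13Params.toStage3Params,
      ∀ P : B12.RunParams, B13LeafOfRecord (Θ F i).toStage13Params.toStage3Params (lam13 P))
    (h11 : ∀ (F : T4Family) (i : ι F), ∀ βup β₀ : ℝ, ∃ γ₁₁ : ℝ, 0 < γ₁₁ ∧ ∀ w : WorldP, w.C = (datumOfRecord₁₃SepCoPH F 2 (Θ F i) (hP F i)).C →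
      w.βup = βup → w.β₀ = β₀ → w.γ ≤ γ₁₁ → ∀ P : B12.RunParams, (leavesP w P).b7 → (leavesP w P).b8 → (leavesP w P).b9 → (leavesP w P).b10 → (leavesP w P).b11 →
      (leavesP w P).smallCouplings → (leavesP w P).smallFieldInductive → (leavesP w P).flowControl →
        ∀ k, k < P.K → SLaw₁₃CoPH F 2 (Θ F i) P k → TLaw₁₃CoPH F 2 (Θ F i) P k)
    (h13 : ∀ (F : T4Family) (i : ι F), ∃ γ₁₃ : ℝ, 0 < γ₁₃ ∧ ∃ em ep : ℝ → ℝ,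
        (∀ P : B12.RunParams, ((datumOfRecord₁₃SepCoPH F 2 (Θ F i) (hP F i)).C P).flow.InInterval γ₁₃ P.K → SLaw₁₃CoPH F 2 (Θ F i) P 0 →
      ∀ U : GaugeField (F.P P.K) 0 (SU 2),
        chiβOfRecord₁₃ F 2 (Θ F i).toStage13Params P.K (gOfRecord₁₃ F 2 (Θ F i).toStage13Params P) 0 U *
              Real.exp (-(1 / (gOfRecord₁₃ F 2 (Θ F i).toStage13Params P 0) ^ 2 * wilsonBGOfRecord F 2 (Θ F i).εbg P 0 U)
                - em (gOfRecord₁₃ F 2 (Θ F i).toStage13Params P 0) * (Fintype.card (Site (F.P P.K) 0) : ℝ)) ≤ densOfRecord₁₃ F 2 (Θ F i).toStage13Params P 0 U ∧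
          densOfRecord₁₃ F 2 (Θ F i).toStage13Params P 0 U ≤ Real.exp (ep (gOfRecord₁₃ F 2 (Θ F i).toStage13Params P 0) * (Fintype.card (Site (F.P P.K) 0) : ℝ))) ∧
        (∀ P : B12.RunParams, ((datumOfRecord₁₃SepCoPH F 2 (Θ F i) (hP F i)).C P).flow.InInterval γ₁₃ P.K → ∀ k, k + 1 ≤ P.K → SLaw₁₃CoPH F 2 (Θ F i) P (k + 1) →
      ∀ᵐ U ∂(fieldMeasure (F.P P.K) (k + 1) (SU 2)),
        chiβOfRecord₁₃ F 2 (Θ F i).toStage13Params P.K (gOfRecord₁₃ F 2 (Θ F i).toStage13Params P) (k + 1) U *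
              Real.exp (-(1 / (gOfRecord₁₃ F 2 (Θ F i).toStage13Params P (k + 1)) ^ 2 * wilsonBGOfRecord F 2 (Θ F i).εbg P (k + 1) U)
                - em (gOfRecord₁₃ F 2 (Θ F i).toStage13Params P (k + 1)) * (Fintype.card (Site (F.P P.K) (k + 1)) : ℝ)) ≤ densOfRecord₁₃ F 2 (Θ F i).toStage13Params P (k + 1) U ∧
          densOfRecord₁₃ F 2 (Θ F i).toStage13Params P (k + 1) U ≤ Real.exp (ep (gOfRecord₁₃ F 2 (Θ F i).toStage13Params P (k + 1)) * (Fintype.card (Site (F.P P.K) (k + 1)) : ℝ))))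
    (hrowsR : ∀ (F : T4Family) (i : ι F), ∃ (b : ℕ → ℝ) (r γ₀ M : ℝ), 0 < γ₀ ∧
        (∀ (n : ℕ) (gs : ℕ → ℝ), RGEqH n (betaOfRecord₁₃ F 2 (Θ F i).toStage13Params) gs → Step.InInterval γ₀ n gs → ∀ k, k ≤ n → |betaOfRecord₁₃ F 2 (Θ F i).toStage13Params k (prefixOf gs k) - b k| ≤ r) ∧
        (∀ (n : ℕ) (gs : ℕ → ℝ), RGEqH n (betaOfRecord₁₃ F 2 (Θ F i).toStage13Params) gs → Step.InInterval γ₀ n gs → ∀ k, k ≤ n → -M ≤ ∑ j ∈ Finset.Ico k n, betaOfRecord₁₃ F 2 (Θ F i).toStage13Params j (prefixOf gs j)) ∧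
        ∀ k : ℕ, ContinuousOn (fun x : ℝ => betaOfRecord₁₃ F 2 (Θ F i).toStage13Params k (clampPrefix (betaOfRecord₁₃ F 2 (Θ F i).toStage13Params) γ₀ k x))
          {x : ℝ | 0 < x ∧ x ≤ γ₀ ∧ ∀ j', j' ≤ k → 1 / γ₀ ^ 2 ≤ Y (betaOfRecord₁₃ F 2 (Θ F i).toStage13Params) γ₀ j' x}) :
    Summit.QuantumFields.YangMills.Theses.BalabanUVNodes.StabilityBRunRowsAtRecordR13SepCoPHV := by
  intro F hinh
  obtain ⟨i⟩ := hK0 F hinh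
  exact N24_stabilityBRunRowsR13SepCoPHV_consequent_childrenSplitSlot8Thm1AE_atWitness_of_runRowsCont Slot8 (Θ F i) (hP F i) (hθ F i) (hU F i) (hlaws F i) (hγ₀ F i) (hbox' F i)
    (h05 F i) (h06 F i) (h07 F) (h08 F i) (h09 F i) (h09T F i) (h10 F i) (h11 F i) (h13 F i) (hrowsR F i)


/-! ## §4. THE SHARP NODE-O BILL AT AN ABSTRACT WITNESS: the partial-sum floor (iv) and survivor continuity (C) ONLY — row (i) is PAID BY the two-sided β-box -/

/-- **★★★ K1⁹'s θ-KEYED CONSEQUENT AT `F` AT AN ABSTRACT ADMISSIBLE WITNESS, NODE O OWING ONLY (iv) + (C)** `θ` as in §2 but with the TWO-SIDED β-box `BetaLowerH bl θ.γ (β θ) ∧ BetaUpperH β' θ.γ (β θ)` displayed: row (i) of NODE O's run rows is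
then FREE (`runConstRemainder_zero_of_boxH`: `b := 0`, `r := max β' (−bl)`), so NODE O owes only the partial-sum floor (iv) and survivor continuity (C) at its own window `γ₀`
(shrunk to `min θ.γ γ₀` by `survCont_anti`) — p644387 §4 door-free.  CONDITIONAL; nothing of Bałaban asserted. [cite: Balaban1987RG1, Thm 3 p.264, (5.10) p.293, §1 pp.263–264, (1.20)–(1.22) p.264; Balaban1989LargeFieldII, Thm 1 p.355; Balaban1988Convergent, Cor. 3 (2.50) p.264; Balaban1985RegularSpaces, Prop. 7 (1.145) p.100, Thm 8 (1.146) p.101 (bookkeeping)] -/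
theorem N24_stabilityBRunRowsR13SepCoPHV_consequent_childrenSplitSlot8Thm1AE_atWitness_of_psFloorSurvCont (Slot8 : (θ₃ : Stage3Params) → ResidB8 θ₃ → Prop) (θ : Stage13HParams F 2)
    (hP : θ.Provisos₁₃SepCoPH F 2) (hθ : θ.Admissible F 2) (hU : θ.ZhUnity F 2 ∧ θ.SlotsNondegenerate₁₃ F 2)
    (hlaws : ∀ (P : B12.RunParams) (k : ℕ), k < P.K → TLaw₁₃CoPH F 2 θ P k → SLaw₁₃CoPH F 2 θ P (k + 1))
    {bl β' : ℝ} (hγ₀ : 0 < θ.γ) (hbox : BetaLowerH bl θ.γ (betaOfRecord₁₃ F 2 θ.toStage13Params)) (hbox' : BetaUpperH β' θ.γ (betaOfRecord₁₃ F 2 θ.toStage13Params))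
    (h05 : ∃ lam8 : ResidB8 θ.toStage13Params.toStage3Params, Slot8 θ.toStage13Params.toStage3Params lam8)
    (h06 : ∃ (Mstar : ℕ) (ops : OpsY 2 θ.toStage13Params.toStage3Params Mstar), B9LeafX (Y9OfRecord 2 θ.toStage13Params.toStage3Params Mstar ops))
    (h07 : ∃ ζ : ResidZ F 2, B11Leaf (Z11OfRecord F 2 ζ))
    (h08 : PrintedUV3V 2 θ.L)
    (h09 : ∃ lam12 : ResidB12 F 2 θ.toStage13Params.τ9.M,
      ∀ P : B12.RunParams, B12Sec2to5.Lemma4Printed (F12OfRecord₁₂ F 2 θ.toStage13Params.toStage12Params lam12 P) (lam12 P).consts)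
    (h09T : ∃ γ₉ : ℝ, 0 < γ₉ ∧ ∀ w : WorldP, w.C = (datumOfRecord₁₃SepCoPH F 2 θ hP).C →
      w.γ ≤ γ₉ → ∀ P : B12.RunParams, (leavesP w P).smallCouplings → (leavesP w P).smallFieldInductive)
    (h10 : ∃ lam13 : B12.RunParams → ResidB13 θ.toStage13Params.toStage3Params,
      ∀ P : B12.RunParams, B13LeafOfRecord θ.toStage13Params.toStage3Params (lam13 P))
    (h11 : ∀ βup β₀ : ℝ, ∃ γ₁₁ : ℝ, 0 < γ₁₁ ∧ ∀ w : WorldP, w.C = (datumOfRecord₁₃SepCoPH F 2 θ hP).C →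
      w.βup = βup → w.β₀ = β₀ → w.γ ≤ γ₁₁ → ∀ P : B12.RunParams, (leavesP w P).b7 → (leavesP w P).b8 → (leavesP w P).b9 → (leavesP w P).b10 → (leavesP w P).b11 →
      (leavesP w P).smallCouplings → (leavesP w P).smallFieldInductive → (leavesP w P).flowControl →
        ∀ k, k < P.K → SLaw₁₃CoPH F 2 θ P k → TLaw₁₃CoPH F 2 θ P k)
    (h13 : ∃ γ₁₃ : ℝ, 0 < γ₁₃ ∧ ∃ em ep : ℝ → ℝ,
        (∀ P : B12.RunParams, ((datumOfRecord₁₃SepCoPH F 2 θ hP).C P).flow.InInterval γ₁₃ P.K → SLaw₁₃CoPH F 2 θ P 0 →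
      ∀ U : GaugeField (F.P P.K) 0 (SU 2),
        chiβOfRecord₁₃ F 2 θ.toStage13Params P.K (gOfRecord₁₃ F 2 θ.toStage13Params P) 0 U *
              Real.exp (-(1 / (gOfRecord₁₃ F 2 θ.toStage13Params P 0) ^ 2 * wilsonBGOfRecord F 2 θ.εbg P 0 U)
                - em (gOfRecord₁₃ F 2 θ.toStage13Params P 0) * (Fintype.card (Site (F.P P.K) 0) : ℝ)) ≤ densOfRecord₁₃ F 2 θ.toStage13Params P 0 U ∧
          densOfRecord₁₃ F 2 θ.toStage13Params P 0 U ≤ Real.exp (ep (gOfRecord₁₃ F 2 θ.toStage13Params P 0) * (Fintype.card (Site (F.P P.K) 0) : ℝ))) ∧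
        (∀ P : B12.RunParams, ((datumOfRecord₁₃SepCoPH F 2 θ hP).C P).flow.InInterval γ₁₃ P.K → ∀ k, k + 1 ≤ P.K → SLaw₁₃CoPH F 2 θ P (k + 1) →
      ∀ᵐ U ∂(fieldMeasure (F.P P.K) (k + 1) (SU 2)),
        chiβOfRecord₁₃ F 2 θ.toStage13Params P.K (gOfRecord₁₃ F 2 θ.toStage13Params P) (k + 1) U *
              Real.exp (-(1 / (gOfRecord₁₃ F 2 θ.toStage13Params P (k + 1)) ^ 2 * wilsonBGOfRecord F 2 θ.εbg P (k + 1) U)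
                - em (gOfRecord₁₃ F 2 θ.toStage13Params P (k + 1)) * (Fintype.card (Site (F.P P.K) (k + 1)) : ℝ)) ≤ densOfRecord₁₃ F 2 θ.toStage13Params P (k + 1) U ∧
          densOfRecord₁₃ F 2 θ.toStage13Params P (k + 1) U ≤ Real.exp (ep (gOfRecord₁₃ F 2 θ.toStage13Params P (k + 1)) * (Fintype.card (Site (F.P P.K) (k + 1)) : ℝ))))
    (hpc : ∃ γ₀ M : ℝ, 0 < γ₀ ∧
        (∀ (n : ℕ) (gs : ℕ → ℝ), RGEqH n (betaOfRecord₁₃ F 2 θ.toStage13Params) gs → Step.InInterval γ₀ n gs → ∀ k, k ≤ n → -M ≤ ∑ j ∈ Finset.Ico k n, betaOfRecord₁₃ F 2 θ.toStage13Params j (prefixOf gs j)) ∧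
        ∀ k : ℕ, ContinuousOn (fun x : ℝ => betaOfRecord₁₃ F 2 θ.toStage13Params k (clampPrefix (betaOfRecord₁₃ F 2 θ.toStage13Params) γ₀ k x))
          {x : ℝ | 0 < x ∧ x ≤ γ₀ ∧ ∀ j', j' ≤ k → 1 / γ₀ ^ 2 ≤ Y (betaOfRecord₁₃ F 2 θ.toStage13Params) γ₀ j' x}) :
    ∃ (θ' : Stage13HParams F 2) (h' : θ'.Provisos₁₃SepCoPH F 2) (v' : Revision₁₃ F 2 θ' h'), (θ'.ZhUnity F 2 ∧ θ'.SlotsNondegenerate₁₃ F 2) ∧ θ'.Admissible F 2 ∧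
      B16.EndStatementBPrinted (datumOfRecord₁₃SepCoPHV F 2 θ' h' v').C ∧
      (∃ γ₁ : ℝ, 0 < γ₁ ∧ ∀ γ : ℝ, 0 < γ → γ ≤ γ₁ → ∃ P : B12.RunParams, 1 ≤ P.K ∧ ((datumOfRecord₁₃SepCoPHV F 2 θ' h' v').C P).flow.InInterval γ P.K) ∧
      ∃ (b : ℕ → ℝ) (r γ₀ M : ℝ), 0 < γ₀ ∧
        (∀ (n : ℕ) (gs : ℕ → ℝ), RGEqH n (betaOfRecord₁₃ F 2 θ'.toStage13Params) gs → Step.InInterval γ₀ n gs → ∀ k, k ≤ n → |betaOfRecord₁₃ F 2 θ'.toStage13Params k (prefixOf gs k) - b k| ≤ r) ∧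
        (∀ (n : ℕ) (gs : ℕ → ℝ), RGEqH n (betaOfRecord₁₃ F 2 θ'.toStage13Params) gs → Step.InInterval γ₀ n gs → ∀ k, k ≤ n → -M ≤ ∑ j ∈ Finset.Ico k n, betaOfRecord₁₃ F 2 θ'.toStage13Params j (prefixOf gs j)) ∧
        ∀ k : ℕ, ContinuousOn (fun x : ℝ => betaOfRecord₁₃ F 2 θ'.toStage13Params k (clampPrefix (betaOfRecord₁₃ F 2 θ'.toStage13Params) γ₀ k x))
          {x : ℝ | 0 < x ∧ x ≤ γ₀ ∧ ∀ j', j' ≤ k → 1 / γ₀ ^ 2 ≤ Y (betaOfRecord₁₃ F 2 θ'.toStage13Params) γ₀ j' x} := by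
  obtain ⟨γR, M, hγR, hps, hcont⟩ := hpc
  obtain ⟨hU', hθ', hT1, hwin⟩ := N24_thm1R13SepCoPH_worldBuiltG_childrenSplitSlot8_psFloor_atWitness_pointed Slot8 θ hP hθ hU hlaws hγ₀ hbox'
    h05 h06 h07 h08 h09 h09T h10 h11 hγR hps
  obtain ⟨γ₁₃, hγ₁₃, em, ep, h0, hae⟩ := h13
  obtain ⟨v, hB⟩ := exists_revision₁₃_endStatementBPrinted_of_thm1_of_row0_of_aeRowSucc F 2 _ _ hT1 hγ₁₃ h0 hae
  exact ⟨_, _, v, hU', hθ', hB, hwin, fun _ => 0, max β' (-bl), min θ.γ γR, M, lt_min hγ₀ hγR,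
    runConstRemainder_zero_of_boxH' hbox hbox' (min_le_left θ.γ γR),
    fun n gs hrg hI k hk => hps n gs hrg (fun i hi => ⟨(hI i hi).1, (hI i hi).2.trans (min_le_right θ.γ γR)⟩) k hk,
    survCont_anti (lt_min hγ₀ hγR) (min_le_right θ.γ γR) hcont⟩

/-! ## §5. ★★★★ K1⁹ BY ITS ROUTE NAME FROM AN ABSTRACT WITNESS FAMILY WITH THE SHARP NODE-O BILL: (iv) PS floor + (C) survivor continuity only (row (i) from the two-sided box) -/

/-- **★★★★ K1⁹ BY ITS ROUTE NAME, DOOR-FREE AND WITNESS-FREE, WITH THE SHARP NODE-O BILL** — §3 with the two-sided β-box per index displayed and NODE O's family cut to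
`hpc` = (iv) the run-wise partial-sum floor + (C) survivor continuity (row (i) is free from the box, §4).  CONDITIONAL (audit `proof.conditional`); not a closure; no v10 stub used or
closed; no count moved. [cite: Balaban1987RG1, Thm 3 p.264, (5.10) p.293, §1 pp.263–264; Balaban1989LargeFieldII, Thm 1 p.355; Balaban1988Convergent, Cor. 3 (2.50) p.264; Balaban1985RegularSpaces, Prop. 7 (1.145) p.100, Thm 8 (1.146) p.101 (bookkeeping)] -/
theorem N24_stabilityBRunRowsAtRecordR13SepCoPHV_byName_of_abstractWitnessFamily_childrenSplitSlot8Thm1AE_of_psFloorSurvCont (Slot8 : (θ₃ : Stage3Params) → ResidB8 θ₃ → Prop)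
    (ι : T4Family → Type) (Θ : ∀ F : T4Family, ι F → Stage13HParams F 2) (hK0 : ∀ F : T4Family, Inhabited13 F → Nonempty (ι F))
    (hP : ∀ (F : T4Family) (i : ι F), (Θ F i).Provisos₁₃SepCoPH F 2) (hθ : ∀ (F : T4Family) (i : ι F), (Θ F i).Admissible F 2)
    (hU : ∀ (F : T4Family) (i : ι F), (Θ F i).ZhUnity F 2 ∧ (Θ F i).SlotsNondegenerate₁₃ F 2)
    (hlaws : ∀ (F : T4Family) (i : ι F) (P : B12.RunParams) (k : ℕ), k < P.K → TLaw₁₃CoPH F 2 (Θ F i) P k → SLaw₁₃CoPH F 2 (Θ F i) P (k + 1))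
    (βlo βup : ∀ F : T4Family, ι F → ℝ) (hγ₀ : ∀ (F : T4Family) (i : ι F), 0 < (Θ F i).γ)
    (hbox : ∀ (F : T4Family) (i : ι F), BetaLowerH (βlo F i) (Θ F i).γ (betaOfRecord₁₃ F 2 (Θ F i).toStage13Params))
    (hbox' : ∀ (F : T4Family) (i : ι F), BetaUpperH (βup F i) (Θ F i).γ (betaOfRecord₁₃ F 2 (Θ F i).toStage13Params))
    (h05 : ∀ (F : T4Family) (i : ι F), ∃ lam8 : ResidB8 (Θ F i).toStage13Params.toStage3Params, Slot8 (Θ F i).toStage13Params.toStage3Params lam8)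
    (h06 : ∀ (F : T4Family) (i : ι F), ∃ (Mstar : ℕ) (ops : OpsY 2 (Θ F i).toStage13Params.toStage3Params Mstar), B9LeafX (Y9OfRecord 2 (Θ F i).toStage13Params.toStage3Params Mstar ops))
    (h07 : ∀ F : T4Family, ∃ ζ : ResidZ F 2, B11Leaf (Z11OfRecord F 2 ζ))
    (h08 : ∀ (F : T4Family) (i : ι F), PrintedUV3V 2 (Θ F i).L)
    (h09 : ∀ (F : T4Family) (i : ι F), ∃ lam12 : ResidB12 F 2 (Θ F i).toStage13Params.τ9.M,
      ∀ P : B12.RunParams, B12Sec2to5.Lemma4Printed (F12OfRecord₁₂ F 2 (Θ F i).toStage13Params.toStage12Params lam12 P) (lam12 P).consts)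
    (h09T : ∀ (F : T4Family) (i : ι F), ∃ γ₉ : ℝ, 0 < γ₉ ∧ ∀ w : WorldP, w.C = (datumOfRecord₁₃SepCoPH F 2 (Θ F i) (hP F i)).C →
      w.γ ≤ γ₉ → ∀ P : B12.RunParams, (leavesP w P).smallCouplings → (leavesP w P).smallFieldInductive)
    (h10 : ∀ (F : T4Family) (i : ι F), ∃ lam13 : B12.RunParams → ResidB13 (Θ F i).toStage13Params.toStage3Params,
      ∀ P : B12.RunParams, B13LeafOfRecord (Θ F i).toStage13Params.toStage3Params (lam13 P))
    (h11 : ∀ (F : T4Family) (i : ι F), ∀ βup β₀ : ℝ, ∃ γ₁₁ : ℝ, 0 < γ₁₁ ∧ ∀ w : WorldP, w.C = (datumOfRecord₁₃SepCoPH F 2 (Θ F i) (hP F i)).C →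
      w.βup = βup → w.β₀ = β₀ → w.γ ≤ γ₁₁ → ∀ P : B12.RunParams, (leavesP w P).b7 → (leavesP w P).b8 → (leavesP w P).b9 → (leavesP w P).b10 → (leavesP w P).b11 →
      (leavesP w P).smallCouplings → (leavesP w P).smallFieldInductive → (leavesP w P).flowControl →
        ∀ k, k < P.K → SLaw₁₃CoPH F 2 (Θ F i) P k → TLaw₁₃CoPH F 2 (Θ F i) P k)
    (h13 : ∀ (F : T4Family) (i : ι F), ∃ γ₁₃ : ℝ, 0 < γ₁₃ ∧ ∃ em ep : ℝ → ℝ,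
        (∀ P : B12.RunParams, ((datumOfRecord₁₃SepCoPH F 2 (Θ F i) (hP F i)).C P).flow.InInterval γ₁₃ P.K → SLaw₁₃CoPH F 2 (Θ F i) P 0 →
      ∀ U : GaugeField (F.P P.K) 0 (SU 2),
        chiβOfRecord₁₃ F 2 (Θ F i).toStage13Params P.K (gOfRecord₁₃ F 2 (Θ F i).toStage13Params P) 0 U *
              Real.exp (-(1 / (gOfRecord₁₃ F 2 (Θ F i).toStage13Params P 0) ^ 2 * wilsonBGOfRecord F 2 (Θ F i).εbg P 0 U)
                - em (gOfRecord₁₃ F 2 (Θ F i).toStage13Params P 0) * (Fintype.card (Site (F.P P.K) 0) : ℝ)) ≤ densOfRecord₁₃ F 2 (Θ F i).toStage13Params P 0 U ∧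
          densOfRecord₁₃ F 2 (Θ F i).toStage13Params P 0 U ≤ Real.exp (ep (gOfRecord₁₃ F 2 (Θ F i).toStage13Params P 0) * (Fintype.card (Site (F.P P.K) 0) : ℝ))) ∧
        (∀ P : B12.RunParams, ((datumOfRecord₁₃SepCoPH F 2 (Θ F i) (hP F i)).C P).flow.InInterval γ₁₃ P.K → ∀ k, k + 1 ≤ P.K → SLaw₁₃CoPH F 2 (Θ F i) P (k + 1) →
      ∀ᵐ U ∂(fieldMeasure (F.P P.K) (k + 1) (SU 2)),
        chiβOfRecord₁₃ F 2 (Θ F i).toStage13Params P.K (gOfRecord₁₃ F 2 (Θ F i).toStage13Params P) (k + 1) U *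
              Real.exp (-(1 / (gOfRecord₁₃ F 2 (Θ F i).toStage13Params P (k + 1)) ^ 2 * wilsonBGOfRecord F 2 (Θ F i).εbg P (k + 1) U)
                - em (gOfRecord₁₃ F 2 (Θ F i).toStage13Params P (k + 1)) * (Fintype.card (Site (F.P P.K) (k + 1)) : ℝ)) ≤ densOfRecord₁₃ F 2 (Θ F i).toStage13Params P (k + 1) U ∧
          densOfRecord₁₃ F 2 (Θ F i).toStage13Params P (k + 1) U ≤ Real.exp (ep (gOfRecord₁₃ F 2 (Θ F i).toStage13Params P (k + 1)) * (Fintype.card (Site (F.P P.K) (k + 1)) : ℝ))))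
    (hpc : ∀ (F : T4Family) (i : ι F), ∃ γ₀ M : ℝ, 0 < γ₀ ∧
        (∀ (n : ℕ) (gs : ℕ → ℝ), RGEqH n (betaOfRecord₁₃ F 2 (Θ F i).toStage13Params) gs → Step.InInterval γ₀ n gs → ∀ k, k ≤ n → -M ≤ ∑ j ∈ Finset.Ico k n, betaOfRecord₁₃ F 2 (Θ F i).toStage13Params j (prefixOf gs j)) ∧
        ∀ k : ℕ, ContinuousOn (fun x : ℝ => betaOfRecord₁₃ F 2 (Θ F i).toStage13Params k (clampPrefix (betaOfRecord₁₃ F 2 (Θ F i).toStage13Params) γ₀ k x))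
          {x : ℝ | 0 < x ∧ x ≤ γ₀ ∧ ∀ j', j' ≤ k → 1 / γ₀ ^ 2 ≤ Y (betaOfRecord₁₃ F 2 (Θ F i).toStage13Params) γ₀ j' x}) :
    Summit.QuantumFields.YangMills.Theses.BalabanUVNodes.StabilityBRunRowsAtRecordR13SepCoPHV := by
  intro F hinh
  obtain ⟨i⟩ := hK0 F hinh
  exact N24_stabilityBRunRowsR13SepCoPHV_consequent_childrenSplitSlot8Thm1AE_atWitness_of_psFloorSurvCont Slot8 (Θ F i) (hP F i) (hθ F i) (hU F i) (hlaws F i) (hγ₀ F i) (hbox F i) (hbox' F i)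
    (h05 F i) (h06 F i) (h07 F) (h08 F i) (h09 F i) (h09T F i) (h10 F i) (h11 F i) (h13 F i) (hpc F i)

end Summit.QuantumFields.YangMills.BalabanUVNodes.N24K1R9ByNameOfOpenStubsChildrenSplitSlot8Thm1AEAtAbstractWitness

end
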